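import Literature.Topology.FourManifolds.GompfFramedTwistZero
import Literature.Topology.FourManifolds.GompfFramedSpheresProofs
import HarnessLib

/-!
# The Akbulut–Kirby spheres are standard: leaf set and necessity of [AK1]

Sibling proof file (D-0014, D-0026: no new named facts) of
`Literature/Topology/FourManifolds/CappellShaneson.lean`, working towards its named fact
`Literature.Topology.FourManifolds.nonempty_diffeomorph_sphere_four_of_isCappellShanesonSphereOf_akbulutKirby X`:
every Cappell–Shaneson sphere of the Akbulut–Kirby matrix `A₀ = !![0, 1, 0; 0, 1, 1; 1, 0, 1]`
— either framing of the surgery, i.e. any tubular neighbourhood of the section circle, any mapping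
torus, any realisation of the gluings (the tree's predicate `IsCappellShanesonSphereOf A₀ X`) — is
diffeomorphic to `S⁴` (S. Akbulut, R. Kirby, Topology 24 (1985), §1, one framing, by the Kirby
calculus of Topology 18 (1979) [AK1]; R. Gompf, Topology 30 (1991), the other framing; both at
once: R. Gompf, *More Cappell–Shaneson spheres are standard*, Algebr. Geom. Topol. 10 (2010),
Examples 3.1(a) with Theorem 4.3: "both homotopy spheres arising from `A₀` are standard (by [AK1]
for the untwisted framing and Theorem 4.3 …)").

## What is proved here

The tree already contains Gompf's concrete spheres `X^σ_{A₀} = gompfSphere A₀ γ`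
(`GompfFramedSpheres.lean`; `γ` a smooth framing path from `1` to `A₀`, a representative of the
straightening `σ`), the fact that they *are* Cappell–Shaneson spheres of `A₀`
(`isCappellShanesonSphereOf_gompfSphere_akbulutKirby`), and the **proved** classification
`gompf2010_straightening_classification_holds` (`GompfSectionCircleFramings.lean`: every
Cappell–Shaneson sphere of `A`, in any universe, is diffeomorphic to some `gompfSphere A γ`). Hence:

* `nonempty_diffeomorph_sphere_four_of_isCappellShanesonSphereOf_akbulutKirby_of_gompfSphere`:
  if every concrete `gompfSphere A₀ γ` is `S⁴`, the named fact holds (every universe);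
* `forall_nonempty_diffeomorph_gompfSphere_akbulutKirby_of_forall` and
  `forall_nonempty_diffeomorph_sphere_four_of_isCappellShanesonSphereOf_akbulutKirby_iff`:
  conversely the fact over `X : Type` gives back every `gompfSphere A₀ γ ≅ S⁴`, so **at `Type` the
  named fact is equivalent to "[AK1] for every framing path"**;
* `akbulutKirby1979_linearStraightening_of_forall`, `akbulutKirby1979_sphere_four_of_forall`: in
  particular the fact implies the leaf [AK1] (`akbulutKirby1979_linearStraightening`,
  `GompfFramedSpheres.lean`) — that leaf is *necessary*, no route to the fact avoids it;
* `nonempty_diffeomorph_sphere_four_of_isCappellShanesonSphereOf_akbulutKirby_of_thm43_AK` and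
  `…_of_framedTwist_AK`: the current *sufficient* leaf sets, with every proved ingredient plugged
  in — {framed Theorem 4.3 `gompf2010_thm43`, [AK1]} and {framed Theorem 2.1 for the Δ-moves
  `gompf2010_framedTwist` (**F**), [AK1]} (Theorem 4.3 follows from F:
  `gompf2010_thm43_of_framedTwist`, `GompfFramedTwistZero.lean`).

So the discharge `…_akbulutKirby_holds` is
`…_akbulutKirby_of_framedTwist_AK X gompf2010_framedTwist_holds akbulutKirby1979_linearStraightening_holds`
once the two XL leaves **F** (Gompf 2010, Thm 2.1: fishtail neighbourhood and the multiplicity-one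
logarithmic transformation, Lemma 2.2) and **[AK1]** (Kirby calculus on the handle presentation of
the surgered mapping torus) are discharged; the historical alternative for the second framing
(Gompf 1991, by Kirby calculus) would replace F by another XL Kirby-calculus leaf and is not
vendored (D-0026).

Added (review of the Theorem 4.3 leaf, D-0026): the framing-free Theorem 4.3 leaf
`Literature.Topology.FourManifolds.gompf2010_akbulutKirby_framings` of
`CappellShanesonGompfReduction.lean` ("any two Cappell–Shaneson spheres of `A₀` are
diffeomorphic") is, at `Type`, **equivalent** to the framed Theorem 4.3 `gompf2010_thm43` on
Gompf's concrete spheres (`gompf2010_akbulutKirby_framings_iff_thm43`; `→`: the concrete spheres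
are Cappell–Shaneson spheres of `A₀`; `←`: the proved classification by straightenings), lifts
from `Type` to every pair of universes (`gompf2010_akbulutKirby_framings_univ`), and follows in
one line from **F** (`gompf2010_akbulutKirby_framings_of_framedTwist`, `GompfFramedTwistZero.lean`)
and even from the single framed row move `A ↦ Δ A` of `GompfFramedSpheresProofs.lean`
(`gompf2010_akbulutKirby_framings_of_rowMove_one`). So that leaf needs no further decomposition:
its discharge is `gompf2010_akbulutKirby_framings_of_framedTwist gompf2010_framedTwist_holds` once
**F** — Theorem 2.1 proper, framed, for `k = 1` — lands (in a file downstream of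
`GompfFramedTwistZero.lean`, since the reduction imports the leaf's own file).

## References

* S. Akbulut, R. Kirby, *An exotic involution of `S⁴`*, Topology 18 (1979) 75–81. [AkbulutKirby1979]
* S. Akbulut, R. Kirby, *A potential smooth counterexample in dimension 4 to the Poincaré
  conjecture, the Schoenflies conjecture, and the Andrews–Curtis conjecture*, Topology 24 (1985)
  375–390, §1. [AkbulutKirby1985]
* R. E. Gompf, *Killing the Akbulut–Kirby 4-sphere, with relevance to the Andrews–Curtis and
  Schoenflies problems*, Topology 30 (1991) 97–115.
* R. E. Gompf, *More Cappell–Shaneson spheres are standard*, Algebr. Geom. Topol. 10 (2010)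
  1665–1681, doi:10.2140/agt.2010.10.1665: Examples 3.1(a), §4 ¶2, Thm 4.3. [GompfAGT2010]
-/

open scoped Manifold ContDiff Topology
open Set

noncomputable section

namespace Literature.Topology.FourManifolds

universe u

/-! ### Sufficiency: from the concrete Gompf spheres of `A₀` -/

section AnyUniverse

variable (X : Type u) [TopologicalSpace X] [T2Space X] [SecondCountableTopology X]
  [ChartedSpace (EuclideanSpace ℝ (Fin 4)) X] [IsManifold (𝓡 4) ∞ X] [CompactSpace X]

/-- **The Akbulut–Kirby spheres are standard if Gompf's concrete spheres `X^σ_{A₀}` are.** If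
`gompfSphere A₀ γ ≅ S⁴` for every smooth framing path `γ` from `1` to `A₀`, then every
Cappell–Shaneson sphere `X` of `A₀` (either framing, any universe) is diffeomorphic to `S⁴`: by the
proved classification `gompf2010_straightening_classification_holds` (Gompf 2010, §4 ¶2: "the two
straightenings `σ` … determine … the two resulting diffeomorphism types, which we denote by
`X^σ`"), `X ≅ gompfSphere A₀ γ` for some `γ`. [cite: GompfAGT2010, §4 ¶2 (X^σ well defined; framings ↔ straightenings)] -/
theorem nonempty_diffeomorph_sphere_four_of_isCappellShanesonSphereOf_akbulutKirby_of_gompfSphere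
    (hγ : ∀ γ : SmoothMatrixPath (slRealMatrix akbulutKirbyMatrix),
      Nonempty (gompfSphere akbulutKirbyMatrix γ ≃ₘ⟮𝓡 4, 𝓡 4⟯
        ↥(Metric.sphere (0 : EuclideanSpace ℝ (Fin (4 + 1))) 1))) :
    nonempty_diffeomorph_sphere_four_of_isCappellShanesonSphereOf_akbulutKirby X := by
  intro hX
  obtain ⟨γ, ⟨e⟩⟩ := gompf2010_straightening_classification_holds.{u} akbulutKirbyMatrix X hX
  obtain ⟨f⟩ := hγ γ
  exact ⟨e.trans f⟩

/-- **The Akbulut–Kirby spheres are standard, from the framed Theorem 4.3 and [AK1]** (Gompf 2010,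
Examples 3.1(a): "both homotopy spheres arising from `A₀` are standard (by [AK1] for the untwisted
framing and Theorem 4.3 …)"): every `gompfSphere A₀ γ` is diffeomorphic to
`gompfSphere A₀ σ_lin` (`gompf2010_thm43`), which is `S⁴` (`akbulutKirby1979_linearStraightening`);
conclude by `…_akbulutKirby_of_gompfSphere` (the classification being proved). Leaf set
{Thm 4.3 framed, [AK1]}. [cite: GompfAGT2010, Examples 3.1(a)] -/
theorem nonempty_diffeomorph_sphere_four_of_isCappellShanesonSphereOf_akbulutKirby_of_thm43_AK
    (h43 : gompf2010_thm43) (hAK : akbulutKirby1979_linearStraightening) :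
    nonempty_diffeomorph_sphere_four_of_isCappellShanesonSphereOf_akbulutKirby X :=
  nonempty_diffeomorph_sphere_four_of_isCappellShanesonSphereOf_akbulutKirby_of_gompfSphere X
    fun γ ↦ by
      obtain ⟨e⟩ := h43 γ akbulutKirbyLinearPath
      obtain ⟨f⟩ := hAK
      exact ⟨e.trans f⟩

/-- **The Akbulut–Kirby spheres are standard, from the framed Theorem 2.1 (F) and [AK1]** — the
current leaf set of the named fact: Theorem 4.3 follows from **F** alone
(`gompf2010_thm43_of_framedTwist`: W, Cj, P1, P2 and F₀ ← F are proved in the tree), then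
`…_akbulutKirby_of_thm43_AK`. The discharge `…_akbulutKirby_holds` is this theorem applied to
`gompf2010_framedTwist_holds` and `akbulutKirby1979_linearStraightening_holds` once those land
(Gompf 2010, Examples 3.1(a), Thm 2.1, Thm 4.3; Akbulut–Kirby 1979). [cite: GompfAGT2010, Examples 3.1(a)] -/
theorem nonempty_diffeomorph_sphere_four_of_isCappellShanesonSphereOf_akbulutKirby_of_framedTwist_AK
    (hF : gompf2010_framedTwist) (hAK : akbulutKirby1979_linearStraightening) :
    nonempty_diffeomorph_sphere_four_of_isCappellShanesonSphereOf_akbulutKirby X :=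
  nonempty_diffeomorph_sphere_four_of_isCappellShanesonSphereOf_akbulutKirby_of_thm43_AK X
    (gompf2010_thm43_of_framedTwist hF) hAK

end AnyUniverse

/-! ### Necessity: the fact over `Type` returns every concrete sphere, in particular [AK1] -/

section TypeZero

/-- **Every concrete Gompf sphere `X^σ_{A₀}` is `S⁴` if the Akbulut–Kirby spheres are standard**
(converse of `…_akbulutKirby_of_gompfSphere` at `Type`): `gompfSphere A₀ γ` is a closed smooth
4-manifold in `Type` and a Cappell–Shaneson sphere of `A₀`
(`isCappellShanesonSphereOf_gompfSphere_akbulutKirby`, Gompf 2010, §4), so the named fact applies to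
it. [cite: GompfAGT2010, §4 (the manifolds X^σ, after Def. 4.1)] -/
theorem forall_nonempty_diffeomorph_gompfSphere_akbulutKirby_of_forall
    (h : ∀ (X : Type) [TopologicalSpace X] [T2Space X] [SecondCountableTopology X]
      [ChartedSpace (EuclideanSpace ℝ (Fin 4)) X] [IsManifold (𝓡 4) ∞ X] [CompactSpace X],
      nonempty_diffeomorph_sphere_four_of_isCappellShanesonSphereOf_akbulutKirby X)
    (γ : SmoothMatrixPath (slRealMatrix akbulutKirbyMatrix)) :
    Nonempty (gompfSphere akbulutKirbyMatrix γ ≃ₘ⟮𝓡 4, 𝓡 4⟯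
      ↥(Metric.sphere (0 : EuclideanSpace ℝ (Fin (4 + 1))) 1)) :=
  h (gompfSphere akbulutKirbyMatrix γ) (isCappellShanesonSphereOf_gompfSphere_akbulutKirby γ)

/-- **[AK1] is a necessary leaf**: the named fact over `X : Type` implies
`akbulutKirby1979_linearStraightening` (`gompfSphere A₀ σ_lin ≅ S⁴`, Akbulut–Kirby, Topology 18
(1979): the untwisted `A₀`-sphere is `S⁴`), the case `γ = akbulutKirbyLinearPath` of
`forall_nonempty_diffeomorph_gompfSphere_akbulutKirby_of_forall`. [cite: AkbulutKirby1979, main theorem (Σ ≅ S⁴)] -/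
theorem akbulutKirby1979_linearStraightening_of_forall
    (h : ∀ (X : Type) [TopologicalSpace X] [T2Space X] [SecondCountableTopology X]
      [ChartedSpace (EuclideanSpace ℝ (Fin 4)) X] [IsManifold (𝓡 4) ∞ X] [CompactSpace X],
      nonempty_diffeomorph_sphere_four_of_isCappellShanesonSphereOf_akbulutKirby X) :
    akbulutKirby1979_linearStraightening :=
  forall_nonempty_diffeomorph_gompfSphere_akbulutKirby_of_forall h akbulutKirbyLinearPath

/-- The framing-free [AK1] (`akbulutKirby1979_sphere_four`: some Cappell–Shaneson sphere of `A₀`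
is `S⁴`) likewise follows from the named fact over `Type`
(`akbulutKirby1979_sphere_four_of_framed`). [cite: AkbulutKirby1979, main theorem (Σ ≅ S⁴)] -/
theorem akbulutKirby1979_sphere_four_of_forall
    (h : ∀ (X : Type) [TopologicalSpace X] [T2Space X] [SecondCountableTopology X]
      [ChartedSpace (EuclideanSpace ℝ (Fin 4)) X] [IsManifold (𝓡 4) ∞ X] [CompactSpace X],
      nonempty_diffeomorph_sphere_four_of_isCappellShanesonSphereOf_akbulutKirby X) :
    akbulutKirby1979_sphere_four :=
  akbulutKirby1979_sphere_four_of_framed (akbulutKirby1979_linearStraightening_of_forall h)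

/-- **At `Type`, "the Akbulut–Kirby spheres are standard" is equivalent to "[AK1] for every framing
path"**: every Cappell–Shaneson sphere of `A₀` in `Type` is `S⁴` iff every concrete
`gompfSphere A₀ γ` is `S⁴` (`→`: the concrete spheres are Cappell–Shaneson spheres of `A₀`; `←`:
the proved classification by straightenings, Gompf 2010, §4 ¶2). [cite: GompfAGT2010, §4 ¶2 (X^σ well defined; framings ↔ straightenings)] -/
theorem forall_nonempty_diffeomorph_sphere_four_of_isCappellShanesonSphereOf_akbulutKirby_iff :
    (∀ (X : Type) [TopologicalSpace X] [T2Space X] [SecondCountableTopology X]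
      [ChartedSpace (EuclideanSpace ℝ (Fin 4)) X] [IsManifold (𝓡 4) ∞ X] [CompactSpace X],
      nonempty_diffeomorph_sphere_four_of_isCappellShanesonSphereOf_akbulutKirby X) ↔
    ∀ γ : SmoothMatrixPath (slRealMatrix akbulutKirbyMatrix),
      Nonempty (gompfSphere akbulutKirbyMatrix γ ≃ₘ⟮𝓡 4, 𝓡 4⟯
        ↥(Metric.sphere (0 : EuclideanSpace ℝ (Fin (4 + 1))) 1)) :=
  ⟨forall_nonempty_diffeomorph_gompfSphere_akbulutKirby_of_forall, fun hγ X _ _ _ _ _ _ ↦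
    nonempty_diffeomorph_sphere_four_of_isCappellShanesonSphereOf_akbulutKirby_of_gompfSphere X hγ⟩

end TypeZero

/-! ### The framing-free Theorem 4.3 leaf `gompf2010_akbulutKirby_framings`: leaf set and necessity -/

section FramingsLeaf

universe v

/-- **The framing-free Theorem 4.3 from the framed one, classification plugged in.** If all of
Gompf's concrete spheres `X^σ_{A₀} = gompfSphere A₀ γ` are diffeomorphic to each other
(`gompf2010_thm43`, Gompf 2010, Thm 4.3: "The two Cappell–Shaneson spheres given by the matrix `A₀`
… are diffeomorphic"), then any two Cappell–Shaneson spheres `X`, `X'` of `A₀` in the sense of the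
tree's predicate — any mapping torus, any tube (either framing), any universes — are diffeomorphic:
`gompf2010_akbulutKirby_framings_of_framed` with the proved classification
`gompf2010_straightening_classification_holds` (§4 ¶2) in both universes. [cite: GompfAGT2010, Thm 4.3] -/
theorem gompf2010_akbulutKirby_framings_of_thm43 (h43 : gompf2010_thm43) :
    gompf2010_akbulutKirby_framings.{u, v} :=
  gompf2010_akbulutKirby_framings_of_framed gompf2010_straightening_classification_holds
    gompf2010_straightening_classification_holds h43

/-- **The framed Theorem 4.3 is necessary**: the framing-free leaf over `Type` gives back
`gompf2010_thm43`, because each `gompfSphere A₀ γ` is a closed smooth 4-manifold in `Type` and a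
Cappell–Shaneson sphere of `A₀` (`isCappellShanesonSphereOf_gompfSphere_akbulutKirby`, Gompf 2010,
§4: the manifolds `X^σ`). [cite: GompfAGT2010, Thm 4.3] -/
theorem gompf2010_thm43_of_akbulutKirby_framings (h : gompf2010_akbulutKirby_framings.{0, 0}) :
    gompf2010_thm43 := fun γ γ' ↦
  h _ _ (isCappellShanesonSphereOf_gompfSphere_akbulutKirby γ)
    (isCappellShanesonSphereOf_gompfSphere_akbulutKirby γ')

/-- **At `Type`, the framing-free Theorem 4.3 leaf is equivalent to the framed Theorem 4.3**:
"any two Cappell–Shaneson spheres of `A₀` are diffeomorphic" iff "all `gompfSphere A₀ γ` are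
diffeomorphic" (Gompf 2010, Thm 4.3 with §4 ¶2: the two straightenings `σ` give "the two
resulting diffeomorphism types" `X^σ_{A₀}`). [cite: GompfAGT2010, Thm 4.3] -/
theorem gompf2010_akbulutKirby_framings_iff_thm43 :
    gompf2010_akbulutKirby_framings.{0, 0} ↔ gompf2010_thm43 :=
  ⟨gompf2010_thm43_of_akbulutKirby_framings, gompf2010_akbulutKirby_framings_of_thm43⟩

/-- **Universe lift**: the framing-free Theorem 4.3 leaf over `Type` implies it for Cappell–Shaneson
spheres of `A₀` in any two universes (through `gompf2010_thm43`, whose concrete spheres live in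
`Type`, and the classification, proved in every universe). [cite: GompfAGT2010, Thm 4.3] -/
theorem gompf2010_akbulutKirby_framings_univ (h : gompf2010_akbulutKirby_framings.{0, 0}) :
    gompf2010_akbulutKirby_framings.{u, v} :=
  gompf2010_akbulutKirby_framings_of_thm43 (gompf2010_thm43_of_akbulutKirby_framings h)

/-- **The framing-free Theorem 4.3 from the single framed row move `A ↦ Δ A`.** If for every
`B ∈ SL(3, ℤ)` in standard form with `det (B - 1) = 1` and every framing path `β`,
`gompfSphere B β ≅ gompfSphere (Δ B) (β.deltaLeft 1)` — Gompf's Theorem 2.1 with `k = 1` for the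
Dehn twist `δ ≃ Δ`, framed as in §4 ¶3 ("`X^{τ·σ}_B = X^σ_A`") — then any two Cappell–Shaneson
spheres of `A₀` are diffeomorphic: **F** follows from that single move
(`gompf2010_framedTwist_of_one`: all `k` by induction along the unipotent line, the column move by
conjugation by `A`), and Theorem 4.3 from **F** (`gompf2010_akbulutKirby_framings_of_framedTwist`:
W, Cj, P1, P2, F₀ ← F and the classification are proved in the tree). This is the whole distance
between the leaf and its discharge. [cite: GompfAGT2010, Thm 4.3 (proof: four applications of Thm 2.1) and §4 ¶3] -/
theorem gompf2010_akbulutKirby_framings_of_rowMove_one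
    (h1 : ∀ (B : Matrix.SpecialLinearGroup (Fin 3) ℤ), IsGompfStandardForm B →
      ((B : Matrix (Fin 3) (Fin 3) ℤ) - 1).det = 1 → ∀ (β : SmoothMatrixPath (slRealMatrix B)),
        Nonempty (gompfSphere B β ≃ₘ⟮𝓡 4, 𝓡 4⟯
          gompfSphere (gompfDelta ^ (1 : ℤ) * B) (β.deltaLeft 1))) :
    gompf2010_akbulutKirby_framings.{u, v} :=
  gompf2010_akbulutKirby_framings_of_framedTwist (gompf2010_framedTwist_of_one h1)

end FramingsLeaf

end Literature.Topology.FourManifolds
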